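import Literature.NumberTheory.LFunctions.ConreyIwaniec2002Prop91FarCompanions
import Literature.NumberTheory.LFunctions.ClassGroupLFunctionConvexity
import Mathlib.NumberTheory.Harmonic.Bounds
import HarnessLib

/-!
# Conrey–Iwaniec (2002), §§7–8: pointwise bounds for `L(½+iu,ψ)` on the whole critical line

B. Conrey, H. Iwaniec, *Spacing of zeros of Hecke L-functions and the class number problem*,
Acta Arith. 103 (2002), §§7–8 [held text `paper:arxiv-math_0111012`, p0017–p0019]. For
`K = ℚ(√−q)` (`q` odd `> 4`) and `ψ ∈ Ĉℓ(K)`, three POINTWISE bounds for `L(½+iu,ψ)`, the input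
through which Proposition 9.1 tolerates REMOTE companions (`ConreyIwaniec2002Prop91AnyCompanions`):

* `norm_afeA_sq_le_conv` — the main sum of the approximate functional equation (7.12) at
  convexity strength in the height: `|A(½+iu)|² ≤ C·Y₂(1 + log Y₂)⁴(3 + log Y₂)`,
  `Y₂ = Q|½+iu| + 2`, `|u| ≥ 1`, from the kernel bound `|V_s(y)| ≪ (1 + y/|s|)^{−6}` (7.16)
  (tree `afeV_bounds`), `|λ(n)| ≤ d(n)`, Cauchy, the tree's `Σ d(n)²(1+n/Y)^{−8} ≪ Y(1+log Y)^4`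
  (`divisorSq_weighted_tsum_le`) and `Σ n^{−1}(1+n/Y)^{−4} ≤ 3 + log Y`;
* `norm_le_crude` — `|L(½+iu,ψ)| ≤ 2qe⁴(|u|+3)³` for every `u`, from the tree's uniform convexity
  bound `|(s−1)L(s,ψ)| ≤ |d_K|e^{2n_K}|s+5/2|^{n_K+1}` ([Rademacher1959, Thm 4],
  `norm_sub_one_mul_classGroupLFunction_le`);
* `norm_sq_le_of_large` — the ONE-POINT discrete mean square:
  `|L(½+iu,ψ)|² ≤ C·(T′(log q)^7 + T′ℒ(T′)(log T′)^4)`, `T′ = |u|/2`, whenever `q^66 ≤ |u|/2`,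
  `e^{(log q)²} ≤ |u|/2` (both signs of `u`: `A_ψ(s̄) = conj A_{ψ⁻¹}(s)`), from Proposition 6.4
  (binder `h64`) through the tree's `main_meanSquares` (ii), `sum_norm_shortLSum_sq_le` and
  `norm_afeR_half_le` at the one-point set `{|u|}` of the window `(|u|/2, |u|]`.
All PROVED; no definition, no named fact.

«The programme SEARCHES and TYPES; no claim about Landau–Siegel zeros, Theorems 1–2 of
arXiv:2211.02515 or a repaired Margin232 until a kernel theorem says so.»

## References
* [ConreyIwaniec2002] B. Conrey, H. Iwaniec, Acta Arith. 103 (2002) 259–312, arXiv:math/0111012: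
  Lemma 7.2 (7.16), Proposition 7.1 (7.12), §8 (8.7)–(8.10).
* [Rademacher1959] H. Rademacher, Math. Z. 72 (1959), Theorem 4.
-/

noncomputable section

open scoped NumberField ComplexConjugate
open Complex

namespace Literature.NumberTheory.LFunctions

namespace ConreyIwaniec2002

open NumberField

/-! ### §1. Two weighted sums -/

/-- `Σ_{n ∈ s} n^{−1}(1 + n/Y)^{−4} ≤ 3 + log Y` for `Y ≥ 2` and any finite `s ⊂ ℕ` (harmonic part
`n ≤ Y`: `≤ 1 + log Y`; tail `n > Y`: `n^{−1}(1+n/Y)^{−4} ≤ Y/n²`, `Σ_{n>Y} n^{−2} ≤ 2/Y`);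
private plumbing. [folklore] -/
private theorem sum_inv_mul_weight_le (s : Finset ℕ) {Y : ℝ} (hY : 2 ≤ Y) :
    ∑ n ∈ s, ((n : ℝ)⁻¹ * ((1 + (n : ℝ) / Y) ^ 4)⁻¹) ≤ 3 + Real.log Y := by
  classical
  have hY0 : 0 < Y := by linarith
  set M : ℕ := ⌊Y⌋₊ with hM
  have hMY : (M : ℝ) ≤ Y := Nat.floor_le hY0.le
  have hYM : Y < (M : ℝ) + 1 := Nat.lt_floor_add_one Y
  have hM2 : 2 ≤ M := by
    rw [hM]; exact Nat.le_floor (by exact_mod_cast hY)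
  have hf0 : ∀ n : ℕ, 0 ≤ (n : ℝ)⁻¹ * ((1 + (n : ℝ) / Y) ^ 4)⁻¹ := fun n => by positivity
  -- split at `M`
  rw [← Finset.sum_filter_add_sum_filter_not s (fun n => n ≤ M)]
  have h1 : ∑ n ∈ s.filter (fun n => n ≤ M), ((n : ℝ)⁻¹ * ((1 + (n : ℝ) / Y) ^ 4)⁻¹) ≤
      1 + Real.log Y := by
    calc ∑ n ∈ s.filter (fun n => n ≤ M), ((n : ℝ)⁻¹ * ((1 + (n : ℝ) / Y) ^ 4)⁻¹)
        ≤ ∑ n ∈ Finset.range (M + 1), ((n : ℝ)⁻¹ * ((1 + (n : ℝ) / Y) ^ 4)⁻¹) := by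
          refine Finset.sum_le_sum_of_subset_of_nonneg (fun n hn => ?_) fun n _ _ => hf0 n
          rw [Finset.mem_filter] at hn
          exact Finset.mem_range.2 (by omega)
      _ ≤ ∑ n ∈ Finset.range (M + 1), (n : ℝ)⁻¹ := by
          refine Finset.sum_le_sum fun n _ => ?_
          have h1 : ((1 + (n : ℝ) / Y) ^ 4)⁻¹ ≤ 1 := by
            apply inv_le_one_of_one_le₀
            exact one_le_pow₀ (le_add_of_nonneg_right (by positivity))
          have h0 : 0 ≤ (n : ℝ)⁻¹ := by positivity
          nlinarith
      _ = ∑ n ∈ Finset.Icc 1 M, (n : ℝ)⁻¹ := by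
          rw [Finset.range_eq_Ico, ← Finset.insert_Ico_succ_left_eq_Ico (Nat.succ_pos M),
            Finset.sum_insert (by simp)]
          simp [Finset.Ico_add_one_right_eq_Icc]
      _ = (harmonic M : ℝ) := by
          rw [harmonic_eq_sum_Icc]; push_cast; rfl
      _ ≤ 1 + Real.log M := harmonic_le_one_add_log M
      _ ≤ 1 + Real.log Y := by
          have : (0 : ℝ) < M := by exact_mod_cast (by omega : 0 < M)
          linarith [Real.log_le_log this hMY]
  have h2 : ∑ n ∈ s.filter (fun n => ¬ n ≤ M), ((n : ℝ)⁻¹ * ((1 + (n : ℝ) / Y) ^ 4)⁻¹) ≤ 2 := by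
    -- `n ≥ M + 1 > Y`: `n⁻¹ (1 + n/Y)⁻⁴ ≤ Y n⁻²`
    have hsub : s.filter (fun n => ¬ n ≤ M) ⊆ Finset.Ioo M (s.sup id + 1) := by
      intro n hn
      rw [Finset.mem_filter] at hn
      rw [Finset.mem_Ioo]
      refine ⟨by omega, Nat.lt_succ_of_le ?_⟩
      exact Finset.le_sup (f := id) hn.1
    calc ∑ n ∈ s.filter (fun n => ¬ n ≤ M), ((n : ℝ)⁻¹ * ((1 + (n : ℝ) / Y) ^ 4)⁻¹)
        ≤ ∑ n ∈ Finset.Ioo M (s.sup id + 1), ((n : ℝ)⁻¹ * ((1 + (n : ℝ) / Y) ^ 4)⁻¹) :=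
          Finset.sum_le_sum_of_subset_of_nonneg hsub fun n _ _ => hf0 n
      _ ≤ ∑ n ∈ Finset.Ioo M (s.sup id + 1), Y * ((n : ℝ) ^ 2)⁻¹ := by
          refine Finset.sum_le_sum fun n hn => ?_
          rw [Finset.mem_Ioo] at hn
          have hn1 : (M : ℝ) + 1 ≤ n := by exact_mod_cast hn.1
          have hnpos : (0 : ℝ) < n := by linarith
          have hYn : Y ≤ n := by linarith
          -- `(1 + n/Y)^4 ≥ 1 + n/Y ≥ n/Y`
          have hge : (n : ℝ) / Y ≤ (1 + (n : ℝ) / Y) ^ 4 := by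
            have h0 : 0 ≤ (n : ℝ) / Y := by positivity
            calc (n : ℝ) / Y ≤ 1 + (n : ℝ) / Y := by linarith
              _ ≤ (1 + (n : ℝ) / Y) ^ 4 := le_self_pow₀ (by linarith) (by norm_num)
          have hpos : 0 < (n : ℝ) / Y := by positivity
          calc (n : ℝ)⁻¹ * ((1 + (n : ℝ) / Y) ^ 4)⁻¹ ≤ (n : ℝ)⁻¹ * ((n : ℝ) / Y)⁻¹ := by
                gcongr
            _ = Y * ((n : ℝ) ^ 2)⁻¹ := by field_simp
      _ = Y * ∑ n ∈ Finset.Ioo M (s.sup id + 1), ((n : ℝ) ^ 2)⁻¹ := by rw [Finset.mul_sum]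
      _ ≤ Y * (2 / ((M : ℝ) + 1)) := by
          gcongr
          exact sum_Ioo_inv_sq_le M (s.sup id + 1)
      _ ≤ 2 := by
          rw [mul_div_assoc', div_le_iff₀ (by positivity)]
          nlinarith
  linarith

/-! ### §2. The approximate functional equation pointwise: convexity strength in the height -/

/-- **`|A(½+iu)|² ≤ C·Y₂(1 + log Y₂)⁴(3 + log Y₂)`**, `Y₂ = Q|½+iu| + 2`, for `|u| ≥ 1` (all `ψ`,
`K = ℚ(√−q)`): from `|V_s(y)| ≪ (1 + y/|s|)^{−6}` (7.16), `|λ(n)| ≤ d(n)`, Cauchy,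
`Σ d(n)²(1+n/Y)^{−8} ≪ Y(1+log Y)^4` and `Σ n^{−1}(1+n/Y)^{−4} ≤ 3 + log Y` — the trivial
(convexity-strength) bound for the main sum of (7.12). [cite: ConreyIwaniec2002, Lemma 7.2 (7.16); Proposition 7.1 (7.12)] -/
theorem norm_afeA_sq_le_conv :
    ∃ C : ℝ, 0 < C ∧
    ∀ (q : ℕ) [NeZero q], 4 < q → ∀ χ : DirichletCharacter ℂ q,
      χ.IsPrimitive → χ.IsQuadratic → χ.Odd →
        ∀ (K : Type) [Field K] [NumberField K],
          Module.finrank ℚ K = 2 → NumberField.discr K = -(q : ℤ) →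
            ∀ (ψ : ClassGroup (𝓞 K) →* ℂˣ) (u : ℝ), 1 ≤ |u| →
              ‖afeA K ψ q (1 / 2 + u * I)‖ ^ 2 ≤
                C * (condQ q * ‖(1 / 2 : ℂ) + u * I‖ + 2) *
                  (1 + Real.log (condQ q * ‖(1 / 2 : ℂ) + u * I‖ + 2)) ^ 4 *
                  (3 + Real.log (condQ q * ‖(1 / 2 : ℂ) + u * I‖ + 2)) := by
  obtain ⟨CV, hCV, hV, -⟩ := afeV_bounds
  obtain ⟨Cd, hCd, hdiv⟩ := divisorSq_weighted_tsum_le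
  refine ⟨CV ^ 2 * Cd, by positivity, fun q _ hq χ hprim hquad hodd K _ _ h2 hdisc ψ u hu => ?_⟩
  classical
  have hq0 : 0 < q := by omega
  set w : ℂ := 1 / 2 + u * I with hw
  have hwre : w.re = 1 / 2 := by simp [hw]
  have hwim : |w.im| = |u| := by simp [hw]
  have hw0 : 0 < ‖w‖ := by
    have := Complex.abs_im_le_norm w
    rw [hwim] at this
    linarith
  have hQ : 0 < condQ q := condQ_pos hq0
  set Y : ℝ := condQ q * ‖w‖ with hY
  have hY0 : 0 < Y := by positivity
  set Y₂ : ℝ := Y + 2 with hY₂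
  have hY₂2 : 2 ≤ Y₂ := by rw [hY₂]; linarith
  have hY₂0 : 0 < Y₂ := by linarith
  have hYY₂ : Y ≤ Y₂ := by rw [hY₂]; linarith
  have hlogY₂ : 0 ≤ Real.log Y₂ := Real.log_nonneg (by linarith)
  -- the kernel bound on `Re w = 1/2`, `|Im w| ≥ 1`
  have hVw : ∀ y : ℝ, 0 < y → ‖afeV w y‖ ≤ CV * ((1 + y / ‖w‖) ^ 6)⁻¹ := fun y hy =>
    (hV w y (by rw [hwre]; norm_num) (by rw [hwre]; norm_num) (by rw [hwim]; exact hu) hy).1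
  have hlam := norm_twistCount_le_card_divisors hprim hquad hodd K h2 hdisc ψ
  -- the two factors of Cauchy
  set a : ℕ → ℝ := fun n => (n.divisors.card : ℝ) * ((1 + (n : ℝ) / Y₂) ^ 4)⁻¹ with ha
  set b : ℕ → ℝ := fun n => (n : ℝ) ^ (-(1 / 2 : ℝ)) * ((1 + (n : ℝ) / Y₂) ^ 2)⁻¹ with hb
  -- termwise bound `‖term n‖ ≤ CV · a n · b n`
  have hterm : ∀ n : ℕ, ‖LSeries.term (fun n => twistCount K (classGroupCharIdealHom ψ) n *
      afeV w (n / condQ q)) w n‖ ≤ CV * (a n * b n) := by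
    intro n
    rcases eq_or_ne n 0 with rfl | hn
    · simp [LSeries.term_zero, ha]
    have hn0 : (0 : ℝ) < n := by exact_mod_cast Nat.pos_of_ne_zero hn
    rw [LSeries.term_of_ne_zero hn, norm_div, norm_mul,
      Complex.norm_natCast_cpow_of_pos (Nat.pos_of_ne_zero hn), hwre]
    have hy : 0 < (n : ℝ) / condQ q := div_pos hn0 hQ
    have h1 := hVw _ hy
    have hyw : (n : ℝ) / condQ q / ‖w‖ = (n : ℝ) / Y := by rw [hY, div_div]
    rw [hyw] at h1
    -- `(1 + n/Y)^{-6} ≤ (1 + n/Y₂)^{-6} = (1+n/Y₂)^{-4} (1+n/Y₂)^{-2}`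
    have hmono : ((1 + (n : ℝ) / Y) ^ 6)⁻¹ ≤ ((1 + (n : ℝ) / Y₂) ^ 6)⁻¹ := by
      apply inv_anti₀ (by positivity)
      apply pow_le_pow_left₀ (by positivity)
      have : (n : ℝ) / Y₂ ≤ (n : ℝ) / Y := div_le_div_of_nonneg_left hn0.le hY0 hYY₂
      linarith
    have hsplit : ((1 + (n : ℝ) / Y₂) ^ 6)⁻¹ =
        ((1 + (n : ℝ) / Y₂) ^ 4)⁻¹ * ((1 + (n : ℝ) / Y₂) ^ 2)⁻¹ := by
      rw [← mul_inv, ← pow_add]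
    have hrpow : (n : ℝ) ^ (-(1 / 2 : ℝ)) = ((n : ℝ) ^ (1 / 2 : ℝ))⁻¹ := Real.rpow_neg hn0.le _
    have hnhalf : 0 < (n : ℝ) ^ (1 / 2 : ℝ) := Real.rpow_pos_of_pos hn0 _
    calc ‖twistCount K (classGroupCharIdealHom ψ) n‖ * ‖afeV w (n / condQ q)‖ /
          (n : ℝ) ^ (1 / 2 : ℝ)
        ≤ (n.divisors.card : ℝ) * (CV * ((1 + (n : ℝ) / Y₂) ^ 6)⁻¹) / (n : ℝ) ^ (1 / 2 : ℝ) := by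
          gcongr
          · exact hlam n
          · exact h1.trans (by gcongr)
      _ = CV * (a n * b n) := by
          rw [hsplit]
          simp only [ha, hb, hrpow]
          rw [div_eq_mul_inv]
          ring
  -- summability of the terms
  have hsum : Summable fun n : ℕ => ‖LSeries.term (fun n => twistCount K (classGroupCharIdealHom ψ) n *
      afeV w (n / condQ q)) w n‖ :=
    (summable_term_afeA hq hprim hquad hodd K h2 hdisc ψ hwre (by rw [hwim]; exact hu)).norm
  -- the two finite Cauchy factors
  have hA2 : ∀ s : Finset ℕ, ∑ n ∈ s, a n ^ 2 ≤ Cd * Y₂ * (1 + Real.log Y₂) ^ 4 := by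
    intro s
    obtain ⟨hsd, hbd⟩ := hdiv Y₂ hY₂2
    calc ∑ n ∈ s, a n ^ 2 = ∑ n ∈ s, ((1 + (n : ℝ) / Y₂) ^ 8)⁻¹ * (n.divisors.card : ℝ) ^ 2 := by
          refine Finset.sum_congr rfl fun n _ => ?_
          rw [ha]; simp only
          generalize (1 + (n : ℝ) / Y₂) = x
          ring
      _ ≤ ∑' n : ℕ, ((1 + (n : ℝ) / Y₂) ^ 8)⁻¹ * (n.divisors.card : ℝ) ^ 2 :=
          hsd.sum_le_tsum s fun n _ => by positivity
      _ ≤ Cd * Y₂ * (1 + Real.log Y₂) ^ 4 := hbd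
  have hB2 : ∀ s : Finset ℕ, ∑ n ∈ s, b n ^ 2 ≤ 3 + Real.log Y₂ := by
    intro s
    calc ∑ n ∈ s, b n ^ 2 = ∑ n ∈ s, ((n : ℝ)⁻¹ * ((1 + (n : ℝ) / Y₂) ^ 4)⁻¹) := by
          refine Finset.sum_congr rfl fun n _ => ?_
          rw [hb]; simp only
          have h1 : ((n : ℝ) ^ (-(1 / 2 : ℝ))) ^ 2 = (n : ℝ)⁻¹ := by
            rw [← Real.rpow_natCast, ← Real.rpow_mul (Nat.cast_nonneg n), ← Real.rpow_neg_one]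
            norm_num
          have h2 : (((1 + (n : ℝ) / Y₂) ^ 2)⁻¹) ^ 2 = ((1 + (n : ℝ) / Y₂) ^ 4)⁻¹ := by
            generalize (1 + (n : ℝ) / Y₂) = x
            ring
          rw [mul_pow, h1, h2]
      _ ≤ 3 + Real.log Y₂ := sum_inv_mul_weight_le s hY₂2
  -- the bound for every finite partial sum, hence for the `tsum`
  have hB : ‖afeA K ψ q w‖ ≤ CV * (Real.sqrt (Cd * Y₂ * (1 + Real.log Y₂) ^ 4) *
      Real.sqrt (3 + Real.log Y₂)) := by
    have h1 : ‖afeA K ψ q w‖ ≤ ∑' n : ℕ, ‖LSeries.term (fun n =>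
        twistCount K (classGroupCharIdealHom ψ) n * afeV w (n / condQ q)) w n‖ :=
      norm_tsum_le_tsum_norm hsum
    refine h1.trans (hsum.tsum_le_of_sum_le fun s => ?_)
    calc ∑ n ∈ s, ‖LSeries.term (fun n => twistCount K (classGroupCharIdealHom ψ) n *
            afeV w (n / condQ q)) w n‖
        ≤ ∑ n ∈ s, CV * (a n * b n) := Finset.sum_le_sum fun n _ => hterm n
      _ = CV * ∑ n ∈ s, a n * b n := by rw [Finset.mul_sum]
      _ ≤ CV * (Real.sqrt (∑ n ∈ s, a n ^ 2) * Real.sqrt (∑ n ∈ s, b n ^ 2)) := by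
          gcongr
          rw [← Real.sqrt_mul (Finset.sum_nonneg fun i _ => sq_nonneg (a i))]
          exact (le_abs_self _).trans (Real.abs_le_sqrt (Finset.sum_mul_sq_le_sq_mul_sq s a b))
      _ ≤ CV * (Real.sqrt (Cd * Y₂ * (1 + Real.log Y₂) ^ 4) * Real.sqrt (3 + Real.log Y₂)) := by
          gcongr
          · exact hA2 s
          · exact hB2 s
  have h0 : 0 ≤ ‖afeA K ψ q w‖ := norm_nonneg _
  calc ‖afeA K ψ q w‖ ^ 2
      ≤ (CV * (Real.sqrt (Cd * Y₂ * (1 + Real.log Y₂) ^ 4) * Real.sqrt (3 + Real.log Y₂))) ^ 2 :=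
        pow_le_pow_left₀ h0 hB 2
    _ = CV ^ 2 * Cd * Y₂ * (1 + Real.log Y₂) ^ 4 * (3 + Real.log Y₂) := by
        rw [mul_pow, mul_pow, Real.sq_sqrt (by positivity), Real.sq_sqrt (by positivity)]
        ring
    _ = CV ^ 2 * Cd * (condQ q * ‖(1 / 2 : ℂ) + u * I‖ + 2) *
          (1 + Real.log (condQ q * ‖(1 / 2 : ℂ) + u * I‖ + 2)) ^ 4 *
          (3 + Real.log (condQ q * ‖(1 / 2 : ℂ) + u * I‖ + 2)) := by rw [hY₂, hY, hw]

/-! ### §3. The crude uniform bound near the real axis -/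

variable (K : Type) [Field K] [NumberField K]

/-- **`|L(½+iu,ψ)| ≤ 2q e⁴(|u| + 3)³`** for every `u` (`K = ℚ(√−q)`): the tree's uniform convexity
bound `|(s−1)L(s,ψ)| ≤ |d_K|e^{2n_K}|s + 5/2|^{n_K+1}` with `|s − 1| ≥ ½` on the critical line.
[cite: Rademacher1959, Theorem 4] -/
theorem norm_le_crude {q : ℕ} (h2 : Module.finrank ℚ K = 2) (hdisc : NumberField.discr K = -(q : ℤ))
    (ψ : ClassGroup (𝓞 K) →* ℂˣ) (u : ℝ) :
    ‖classGroupLFunction K ψ (1 / 2 + u * I)‖ ≤ 2 * q * Real.exp 4 * (|u| + 3) ^ 3 := by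
  set s : ℂ := 1 / 2 + u * I with hs
  have hs1 : s ≠ 1 := by
    intro e
    have := congrArg Complex.re e
    norm_num [hs] at this
  have hre : -1 / 2 ≤ s.re := by norm_num [hs]
  have h := norm_sub_one_mul_classGroupLFunction_le ψ hs1 hre
  rw [h2, hdisc] at h
  have hnat : ((-(q : ℤ)).natAbs : ℝ) = q := by simp
  rw [hnat, norm_mul] at h
  -- `‖s − 1‖ ≥ 1/2`, `‖s + 5/2‖ ≤ |u| + 3`
  have hs1n : (1 / 2 : ℝ) ≤ ‖s - 1‖ := by
    have := Complex.abs_re_le_norm (s - 1)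
    have hre' : (s - 1).re = -1 / 2 := by norm_num [hs]
    rw [hre'] at this
    norm_num at this
    linarith
  have hs5 : ‖s + 5 / 2‖ ≤ |u| + 3 := by
    have e : s + 5 / 2 = (3 : ℂ) + u * I := by rw [hs]; ring
    rw [e]
    calc ‖(3 : ℂ) + u * I‖ ≤ ‖(3 : ℂ)‖ + ‖(u : ℂ) * I‖ := norm_add_le _ _
      _ = |u| + 3 := by
          rw [norm_mul, Complex.norm_I, mul_one, Complex.norm_real, Real.norm_eq_abs]
          norm_num; ring
  have hexp : Real.exp (2 * (2 : ℕ)) = Real.exp 4 := by norm_num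
  rw [hexp] at h
  have hL0 : 0 ≤ ‖classGroupLFunction K ψ s‖ := norm_nonneg _
  have h3 : ‖s + 5 / 2‖ ^ (2 + 1) ≤ (|u| + 3) ^ 3 := pow_le_pow_left₀ (norm_nonneg _) hs5 3
  have hq0 : (0 : ℝ) ≤ q := Nat.cast_nonneg q
  have h4 : (1 / 2 : ℝ) * ‖classGroupLFunction K ψ s‖ ≤ q * Real.exp 4 * (|u| + 3) ^ 3 := by
    calc (1 / 2 : ℝ) * ‖classGroupLFunction K ψ s‖ ≤ ‖s - 1‖ * ‖classGroupLFunction K ψ s‖ :=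
          mul_le_mul_of_nonneg_right hs1n hL0
      _ ≤ q * Real.exp 4 * ‖s + 5 / 2‖ ^ (2 + 1) := h
      _ ≤ q * Real.exp 4 * (|u| + 3) ^ 3 := by gcongr
  linarith

variable {K}

/-! ### §4. The one-point mean square: `|L(½+iu)|²` for `|u|` in the range of Proposition 6.4 -/

/-- **`|A_{ψ′}(½+iv)|² ≤ 2C₁X(v/2) + 2C₂(v/2)(log q)⁵`** at a single height `v` with `q^66 ≤ v/2`,
`e^{(log q)²} ≤ v/2`: the tree's mean squares `(log T′)²Σ|A − N|²` (`main_meanSquares` (ii)) and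
`Σ|N|²` at the one-point set `{v}` of the window `(v/2, v]`; private step.
[cite: ConreyIwaniec2002, §8 (8.7)–(8.9)] -/
theorem norm_afeA_sq_le_of_large (h64 : conreyIwaniec2002_proposition64) :
    ∃ C : ℝ, 0 < C ∧
    ∀ (q : ℕ) [NeZero q], 4 < q → Odd q → ∀ χ : DirichletCharacter ℂ q,
      χ.IsPrimitive → χ.IsQuadratic → χ.Odd →
        ∀ (K : Type) [Field K] [NumberField K],
          Module.finrank ℚ K = 2 → NumberField.discr K = -(q : ℤ) →
            ∀ (ψ : ClassGroup (𝓞 K) →* ℂˣ) (v : ℝ),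
              (q : ℝ) ^ (66 : ℕ) ≤ v / 2 → Real.exp (Real.log q ^ (2 : ℕ)) ≤ v / 2 →
                ‖afeA K ψ q (1 / 2 + v * I)‖ ^ 2 ≤
                  C * (v / 2 * Real.log q ^ (7 : ℕ) +
                    v / 2 * calL χ (v / 2) * Real.log (v / 2) ^ (4 : ℕ)) := by
  obtain ⟨C₁, hC₁, hMS⟩ := main_meanSquares h64 divisorSq_weighted_tsum_le
  obtain ⟨C₂, hC₂, hN⟩ := sum_norm_shortLSum_sq_le
  refine ⟨2 * C₁ + 2 * C₂, by positivity,
    fun q _ hq hodd χ hprim hquad hoddχ K _ _ h2 hdisc ψ v hv hexpv => ?_⟩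
  classical
  set T' : ℝ := v / 2 with hT'
  obtain ⟨hℓ1, -, hLT1, -, hq41, -, hT3, -⟩ := prop81_numerics hq hv hexpv
  have hT'0 : 0 < T' := by linarith
  have hv0 : 0 < v := by linarith
  have hq4T' : (q : ℝ) ^ (4 : ℕ) ≤ T' := by
    have : ((q ^ 4 : ℕ) : ℝ) = (q : ℝ) ^ (4 : ℕ) := by push_cast; ring
    linarith
  -- the one-point set `{v}` in the window `(v/2, v]`
  have hS : IsDyadicPointSet ({v} : Finset ℝ) T' := by
    refine ⟨fun t ht => ?_, fun t ht u hu htu => ?_⟩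
    · rw [Finset.mem_singleton] at ht; subst ht
      exact ⟨by linarith, by linarith⟩
    · rw [Finset.mem_singleton] at ht hu
      exact absurd (ht.trans hu.symm) htu
  have hii := (hMS q hq hodd χ hprim hquad hoddχ K h2 hdisc ψ T' {v} (fun t => t + 1 / 2) hv hexpv hS
    (fun t _ => ⟨by linarith, by
      rw [show t + 1 / 2 - t = (1 / 2 : ℝ) by ring, abs_of_pos (by norm_num)]; norm_num⟩)).2
  rw [Finset.sum_singleton] at hii
  have hNN := hN q hq hodd χ hprim hquad hoddχ K h2 hdisc ψ T' {v} hq4T' hS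
  rw [Finset.sum_singleton] at hNN
  set A := afeA K ψ q (1 / 2 + v * I) with hA
  set Nn := shortLSum K ψ q (1 / 2 + v * I) with hNn
  set X' : ℝ := T' * Real.log q ^ (7 : ℕ) + T' * calL χ T' * Real.log T' ^ (4 : ℕ) with hX'
  have hcal0 : 0 ≤ calL χ T' := calL_nonneg χ (by linarith)
  have hX'0 : 0 ≤ X' := by positivity
  have hAN : ‖A - Nn‖ ^ 2 ≤ C₁ * X' := by
    have h0 : 0 ≤ ‖A - Nn‖ ^ 2 := by positivity
    have h1 : (1 : ℝ) ≤ Real.log T' ^ (2 : ℕ) := one_le_pow₀ hLT1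
    calc ‖A - Nn‖ ^ 2 = 1 * ‖A - Nn‖ ^ 2 := (one_mul _).symm
      _ ≤ Real.log T' ^ (2 : ℕ) * ‖A - Nn‖ ^ 2 := mul_le_mul_of_nonneg_right h1 h0
      _ ≤ C₁ * X' := hii
  have hN5 : ‖Nn‖ ^ 2 ≤ C₂ * X' := by
    refine hNN.trans (mul_le_mul_of_nonneg_left ?_ hC₂.le)
    have h57 : Real.log q ^ (5 : ℕ) ≤ Real.log q ^ (7 : ℕ) := pow_le_pow_right₀ hℓ1 (by norm_num)
    have : 0 ≤ T' * calL χ T' * Real.log T' ^ (4 : ℕ) := by positivity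
    rw [hX']; nlinarith
  have hAle : ‖A‖ ≤ ‖A - Nn‖ + ‖Nn‖ := by
    calc ‖A‖ = ‖(A - Nn) + Nn‖ := by rw [sub_add_cancel]
      _ ≤ ‖A - Nn‖ + ‖Nn‖ := norm_add_le _ _
  have h0 : 0 ≤ ‖A‖ := norm_nonneg _
  calc ‖A‖ ^ 2 ≤ (‖A - Nn‖ + ‖Nn‖) ^ 2 := pow_le_pow_left₀ h0 hAle 2
    _ ≤ 2 * ‖A - Nn‖ ^ 2 + 2 * ‖Nn‖ ^ 2 := by nlinarith [sq_nonneg (‖A - Nn‖ - ‖Nn‖)]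
    _ ≤ 2 * (C₁ * X') + 2 * (C₂ * X') := by gcongr
    _ = (2 * C₁ + 2 * C₂) * X' := by ring

/-- **ONE-POINT MEAN SQUARE: `|L(½+iu,ψ)|² ≤ C·X(|u|/2)`** for `q^66 ≤ |u|/2`, `e^{(log q)²} ≤ |u|/2`
(`X(T′) = T′(log q)^7 + T′ℒ(T′)(log T′)^4`; BOTH signs of `u`, the negative heights through
`A_ψ(s̄) = conj A_{ψ⁻¹}(s)` and `|L| ≤ 2|A| + |R|`), from Proposition 6.4.
[cite: ConreyIwaniec2002, §8 (8.7)–(8.10); Proposition 7.1 (7.12)] -/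
theorem norm_sq_le_of_large (h64 : conreyIwaniec2002_proposition64) :
    ∃ C : ℝ, 0 < C ∧
    ∀ (q : ℕ) [NeZero q], 4 < q → Odd q → ∀ χ : DirichletCharacter ℂ q,
      χ.IsPrimitive → χ.IsQuadratic → χ.Odd →
        ∀ (K : Type) [Field K] [NumberField K],
          Module.finrank ℚ K = 2 → NumberField.discr K = -(q : ℤ) →
            ∀ (ψ : ClassGroup (𝓞 K) →* ℂˣ) (u : ℝ),
              (q : ℝ) ^ (66 : ℕ) ≤ |u| / 2 → Real.exp (Real.log q ^ (2 : ℕ)) ≤ |u| / 2 →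
                ‖classGroupLFunction K ψ (1 / 2 + u * I)‖ ^ 2 ≤
                  C * (|u| / 2 * Real.log q ^ (7 : ℕ) +
                    |u| / 2 * calL χ (|u| / 2) * Real.log (|u| / 2) ^ (4 : ℕ)) := by
  obtain ⟨CA, hCA, hA⟩ := norm_afeA_sq_le_of_large h64
  obtain ⟨M, hM, hR⟩ := norm_afeR_half_le
  refine ⟨8 * CA + 2 * M ^ 2, by positivity,
    fun q _ hq hodd χ hprim hquad hoddχ K _ _ h2 hdisc ψ u hu hexpu => ?_⟩
  have hq0 : 0 < q := by omega
  have hq5 : (5 : ℝ) ≤ q := by exact_mod_cast hq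
  set v : ℝ := |u| with hv
  obtain ⟨hℓ1, -, hLT1, -, hq41, -, hT3, -⟩ := prop81_numerics hq hu hexpu
  have hv0 : 0 < v := by linarith
  -- `‖A_ψ(½+iu)‖ = ‖A_{ψ′}(½+iv)‖` with `ψ′ = ψ` or `ψ⁻¹`
  have hAeq : ∃ ψ' : ClassGroup (𝓞 K) →* ℂˣ,
      ‖afeA K ψ q (1 / 2 + u * I)‖ = ‖afeA K ψ' q (1 / 2 + v * I)‖ := by
    rcases le_or_gt 0 u with hu0 | hu0
    · exact ⟨ψ, by rw [hv, abs_of_nonneg hu0]⟩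
    · refine ⟨ψ⁻¹, ?_⟩
      have huv : u = -v := by rw [hv, abs_of_neg hu0]; ring
      have hconj : (1 / 2 + u * I : ℂ) = conj (1 / 2 + v * I) := by
        rw [huv]
        apply Complex.ext <;> simp
      rw [hconj, ← inv_inv ψ, afeA_inv_conj, inv_inv, RCLike.norm_conj]
  obtain ⟨ψ', hψ'⟩ := hAeq
  have hAv := hA q hq hodd χ hprim hquad hoddχ K h2 hdisc ψ' v hu hexpu
  -- the residual
  have h625 : (5 : ℝ) ^ (4 : ℕ) ≤ (q : ℝ) ^ (4 : ℕ) := pow_le_pow_left₀ (by norm_num) hq5 4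
  have hq4cast : ((q ^ 4 : ℕ) : ℝ) = (q : ℝ) ^ (4 : ℕ) := by push_cast; ring
  have hq_le : (q : ℝ) ≤ (q : ℝ) ^ (4 : ℕ) := le_self_pow₀ (by linarith) (by norm_num)
  have hu4 : 4 ≤ |u| := by norm_num at h625; rw [← hv]; linarith
  have huq : (q : ℝ) + 1 ≤ |u| := by rw [← hv]; linarith
  have hRu := hR q hq0 K h2 hdisc ψ u huq hu4
  have hL := norm_classGroupLFunction_le_afe hq0 K h2 hdisc ψ u
  rw [hψ'] at hL
  set Av := afeA K ψ' q (1 / 2 + v * I)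
  set X' : ℝ := v / 2 * Real.log q ^ (7 : ℕ) + v / 2 * calL χ (v / 2) * Real.log (v / 2) ^ (4 : ℕ)
  have hcal0 : 0 ≤ calL χ (v / 2) := calL_nonneg χ (by linarith)
  have hX'1 : 1 ≤ X' := by
    have h7 : (1 : ℝ) ≤ Real.log q ^ (7 : ℕ) := one_le_pow₀ hℓ1
    have h0 : 0 ≤ v / 2 * calL χ (v / 2) * Real.log (v / 2) ^ (4 : ℕ) := by positivity
    have hv1 : (1 : ℝ) ≤ v / 2 := by linarith
    exact le_add_of_le_of_nonneg (one_le_mul_of_one_le_of_one_le hv1 h7) h0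
  have hL0 : 0 ≤ ‖classGroupLFunction K ψ (1 / 2 + u * I)‖ := norm_nonneg _
  have hLle : ‖classGroupLFunction K ψ (1 / 2 + u * I)‖ ≤ 2 * ‖Av‖ + M := by linarith
  calc ‖classGroupLFunction K ψ (1 / 2 + u * I)‖ ^ 2 ≤ (2 * ‖Av‖ + M) ^ 2 :=
        pow_le_pow_left₀ hL0 hLle 2
    _ ≤ 8 * ‖Av‖ ^ 2 + 2 * M ^ 2 := by nlinarith [sq_nonneg (2 * ‖Av‖ - M)]
    _ ≤ 8 * (CA * X') + 2 * M ^ 2 * X' := by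
        have hM2 : 0 ≤ 2 * M ^ 2 := by positivity
        nlinarith [hAv, mul_le_mul_of_nonneg_left hX'1 hM2]
    _ = (8 * CA + 2 * M ^ 2) * X' := by ring

end ConreyIwaniec2002

end Literature.NumberTheory.LFunctions

end
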